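import Summits.Langlands.Langlands.Theses.SmithKummerSeed
import Summits.Langlands.Langlands.Theorems.IrreducibilityBySelfDualityIrreducibleOffSectorSolvablePrimeIndex

/-!
# `AscentConjugationSolvable` from reciprocity ascent AND descent along Galois layers of prime degree
(crux stmt-Langlands-1094 `SmithKummerSeed.AscentConjugationSolvable`, shared verbatim with routes
BaseFieldAscent / CMFern; `--supports` file = the ASSEMBLY of the crux-strategist's typed decomposition,
re-audit bin RESTATED → BC2 redirect; closes nothing)

The crux says: reciprocity for `GL_n` (both directions, every finite place, all `n`) over every totally real
or CM field implies reciprocity over every CONJUGATION-SOLVABLE field `F` (`F₀ ⊆ F ⊆ E` with `F₀` totally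
real and `E/F₀` finite Galois with solvable group).  This file proves, sorry-free, that it follows from two
per-layer statements, each a consequence of the summit and each stated over existing declarations only:

* **CyclicPrimeAscent** — for every Galois extension of number fields `L/K` of PRIME degree, reciprocity over
  `K` implies reciprocity over `L` (UP-step: automorphic induction + Clifford theory + de-induction over twists
  for direction (A); induction of `ρ`, (B) downstairs, cyclic base change back and matching by (A) upstairs for
  direction (B); Arthur–Clozel Ch. 3 Thms 4.2, 5.1, 6.2; Taylor 1994 §3 / the tree's proved
  `QuadraticWindow.TwistUnpackaging` for the extraction);
* **CyclicPrimeDescent** — for every Galois extension of number fields `L/K` of PRIME degree, reciprocity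
  over `L` implies reciprocity over `K` (DOWN-step: direction (B) over `K` is Arthur–Clozel cyclic descent
  matched through (A) over `K`; direction (A) over `K` — descending `ρ_{BC(π)}` to `Γ_K` and fixing the twist
  at the INERT places — is the open residue of the crux: solvable NON-NORMAL base change, known for `n = 1`
  and for the non-normal cubic lift on `GL_2`, Jacquet–Piatetski-Shapiro–Shalika 1981; cf. Lapid 1998 §1
  "we only have the constructions for normal subgroups").

`ascentConjugationSolvable_of_cyclicPrime : CyclicPrimeAscent → CyclicPrimeDescent → AscentConjugationSolvable`
(hypotheses written out in full) and `ascentConjugationSolvable_of_pieces` (the same over the ROUTE DECLS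
`SmithKummerSeed.CyclicPrimeAscent` = stmt-Langlands-18649 and `SmithKummerSeed.CyclicPrimeDescent` = stmt-Langlands-18645,
filed 2026-08-17 as the two pieces of the crux; this theorem is their glue).  PROOF (solvable Galois theory, no transport of reciprocity along field isomorphisms):
`galois_prime_step` — for `T/K` finite Galois with non-trivial solvable group, either `[T:K]` is prime or there
is an intermediate `M`, Galois of prime degree over `K` (the fixed field of a normal subgroup of prime index,
`exists_normal_prime_index_of_isSolvable`), with `T/M` Galois, solvable, `1 < [T:M] < [T:K]`; hence by strong
induction on the degree over all base fields reciprocity ASCENDS (`recip_ascent_of_isSolvable`) and DESCENDS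
(`recip_descent_of_isSolvable`) along every Galois extension with non-trivial solvable group.  Given the
witness `F₀ ⊆ F ⊆ E`: `E/F` is Galois with solvable group (restriction of scalars embeds `Gal(E/F)` into
`Gal(E/F₀)`); if `[E:F] = 1` then `F ≃ E` over `F₀`, so `F/F₀` is itself Galois solvable and either
`[F:F₀] = 1` (then `F ≃ F₀` is totally real: hypothesis) or we ascend from `F₀` to `F`; otherwise `1 < [E:F]
≤ [E:F₀]`, we ascend from `F₀` to `E` and descend from `E` to `F`.

References: J. Arthur, L. Clozel, *Simple algebras, base change, and the advanced theory of the trace formula*,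
Ann. of Math. Stud. 120 (1989), Ch. 3 [ArthurClozelAMS120]; H. Jacquet, I. Piatetski-Shapiro, J. Shalika,
C. R. Acad. Sci. 292 (1981) [JPSS1981Cubique]; E. Lapid, Doc. Math. 3 (1998) 285–296 [Lapid1998];
R. Taylor, Invent. Math. 116 (1994) [Taylor1994]; D. J. S. Robinson, *A course in the theory of groups*, 5.4.8.
-/

set_option linter.dupNamespace false -- `Summit.Langlands.Langlands.…` is the mandated namespace (D-0017)

noncomputable section

open scoped NumberField
open Literature.NumberTheory.Automorphic Summit.Langlands
open Summit.Langlands.Langlands.Theorems.IrreducibleOffSector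

namespace Summit.Langlands.Langlands.Theorems.AscentConjugationSolvableSplit


/-- **The Galois-theoretic step.**  For a finite Galois extension `T/K` of number fields whose Galois group is
solvable and non-trivial (`1 < [T:K]`): either `[T:K]` is prime, or there is an intermediate field `M`, Galois
of prime degree over `K`, such that `T/M` (automatically Galois) has solvable group and `1 < [T:M] < [T:K]`.
(`M` is the fixed field of a normal subgroup `N ≠ 1` of prime index of `Gal(T/K)`,
`exists_normal_prime_index_of_isSolvable`; if `N = 1` the degree itself is prime.) [folklore] -/
theorem galois_prime_step (K T : Type) [Field K] [NumberField K] [Field T] [NumberField T] [Algebra K T]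
    [IsGalois K T] [IsSolvable (T ≃ₐ[K] T)] (hlt : 1 < Module.finrank K T) :
    (Module.finrank K T).Prime ∨
      ∃ M : IntermediateField K T, IsGalois K M ∧ (Module.finrank K M).Prime ∧
        IsSolvable (T ≃ₐ[M] T) ∧ 1 < Module.finrank M T ∧ Module.finrank M T < Module.finrank K T := by
  haveI : FiniteDimensional K T := Module.Finite.of_restrictScalars_finite ℚ K T
  have hcard : Nat.card (T ≃ₐ[K] T) = Module.finrank K T := IsGalois.card_aut_eq_finrank K T
  haveI : Nontrivial (T ≃ₐ[K] T) := by
    rw [← Finite.one_lt_card_iff_nontrivial, hcard]; exact hlt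
  obtain ⟨N, hN, hp⟩ := exists_normal_prime_index_of_isSolvable (G := T ≃ₐ[K] T)
  haveI := hN
  -- degrees: `[M:K] = [G:N]`, `[T:M] = |N|`
  have hEK : Module.finrank K (IntermediateField.fixedField N) = N.index := by
    rw [← IsGalois.card_aut_eq_finrank, Nat.card_congr (IsGalois.normalAutEquivQuotient N).symm.toEquiv]
    rfl
  have hLE : Module.finrank (IntermediateField.fixedField N) T = Nat.card N :=
    IntermediateField.finrank_fixedField_eq_card N
  by_cases hbot : N = ⊥
  · left
    subst hbot
    rwa [Subgroup.index_bot, hcard] at hp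
  · right
    refine ⟨IntermediateField.fixedField N, IsGalois.of_fixedField_normal_subgroup N, hEK ▸ hp, ?_, ?_, ?_⟩
    · exact solvable_of_surjective (f := (IntermediateField.subgroupEquivAlgEquiv N).toMonoidHom)
        fun x => (IntermediateField.subgroupEquivAlgEquiv N).surjective x
    · rw [hLE]
      exact (Subgroup.one_lt_card_iff_ne_bot N).mpr hbot
    · have hmul : N.index * Nat.card N = Module.finrank K T := by
        rw [← hEK, ← hLE, Module.finrank_mul_finrank]
      rw [← hmul, hLE]
      calc Nat.card N = 1 * Nat.card N := (one_mul _).symm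
        _ < N.index * Nat.card N := Nat.mul_lt_mul_of_pos_right hp.one_lt Nat.card_pos

/-- **Reciprocity ascends along solvable Galois extensions** (with non-trivial group), given the prime-layer
ascent `CyclicPrimeAscent` (written out as the hypothesis `hUp`).  Strong induction on `d = [T:K]` over all base
fields through `galois_prime_step`: a prime degree is one layer; otherwise ascend to the intermediate `M` (one
prime layer) and recurse into `T/M`, of smaller degree `> 1`.
[cite: ArthurClozelAMS120, Ch. 3 Thm. 4.2 and Thm. 6.2] -/
theorem recip_ascent_of_isSolvable
    (hUp : ∀ (K L : Type) [Field K] [NumberField K] [Field L] [NumberField L] [Algebra K L] [IsGalois K L],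
      (Module.finrank K L).Prime → (∃ R : ReciprocityData K, ∀ n : ℕ, 0 < n →
        ∀ hcpt : Literature.NumberTheory.Automorphic.isCompact_glFiniteIntegralLevel n K,
          GlobalLanglandsCorrespondenceGLn n K R hcpt) → (∃ R : ReciprocityData L, ∀ n : ℕ, 0 < n →
        ∀ hcpt : Literature.NumberTheory.Automorphic.isCompact_glFiniteIntegralLevel n L,
          GlobalLanglandsCorrespondenceGLn n L R hcpt)) :
    ∀ (d : ℕ) (K T : Type) [Field K] [NumberField K] [Field T] [NumberField T] [Algebra K T]
      [IsGalois K T] [IsSolvable (T ≃ₐ[K] T)], Module.finrank K T = d → 1 < d → (∃ R : ReciprocityData K, ∀ n : ℕ, 0 < n →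
        ∀ hcpt : Literature.NumberTheory.Automorphic.isCompact_glFiniteIntegralLevel n K,
          GlobalLanglandsCorrespondenceGLn n K R hcpt) → (∃ R : ReciprocityData T, ∀ n : ℕ, 0 < n →
        ∀ hcpt : Literature.NumberTheory.Automorphic.isCompact_glFiniteIntegralLevel n T,
          GlobalLanglandsCorrespondenceGLn n T R hcpt) := by
  intro d
  induction d using Nat.strong_induction_on with
  | _ d ih =>
    intro K T _ _ _ _ _ _ _ hd hlt hK
    rcases galois_prime_step K T (hd ▸ hlt) with hprime | ⟨M, hGal, hpM, hsolv, h1, hltM⟩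
    · exact hUp K T (hd ▸ hprime) hK
    · haveI := hGal
      haveI := hsolv
      haveI : FiniteDimensional K T := Module.Finite.of_restrictScalars_finite ℚ K T
      haveI : NumberField M := NumberField.of_module_finite K M
      exact ih (Module.finrank M T) (hd ▸ hltM) M T rfl h1 (hUp K M hpM hK)

/-- **Reciprocity descends along solvable Galois extensions** (with non-trivial group), given the prime-layer
descent `CyclicPrimeDescent` (written out as the hypothesis `hDown`).  Same induction as
`recip_ascent_of_isSolvable`, run downwards: recurse into `T/M` first, then descend the prime layer `M/K`.
[cite: ArthurClozelAMS120, Ch. 3 Thm. 4.2 and Thm. 6.2] -/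
theorem recip_descent_of_isSolvable
    (hDown : ∀ (K L : Type) [Field K] [NumberField K] [Field L] [NumberField L] [Algebra K L] [IsGalois K L],
      (Module.finrank K L).Prime → (∃ R : ReciprocityData L, ∀ n : ℕ, 0 < n →
        ∀ hcpt : Literature.NumberTheory.Automorphic.isCompact_glFiniteIntegralLevel n L,
          GlobalLanglandsCorrespondenceGLn n L R hcpt) → (∃ R : ReciprocityData K, ∀ n : ℕ, 0 < n →
        ∀ hcpt : Literature.NumberTheory.Automorphic.isCompact_glFiniteIntegralLevel n K,
          GlobalLanglandsCorrespondenceGLn n K R hcpt)) :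
    ∀ (d : ℕ) (K T : Type) [Field K] [NumberField K] [Field T] [NumberField T] [Algebra K T]
      [IsGalois K T] [IsSolvable (T ≃ₐ[K] T)], Module.finrank K T = d → 1 < d → (∃ R : ReciprocityData T, ∀ n : ℕ, 0 < n →
        ∀ hcpt : Literature.NumberTheory.Automorphic.isCompact_glFiniteIntegralLevel n T,
          GlobalLanglandsCorrespondenceGLn n T R hcpt) → (∃ R : ReciprocityData K, ∀ n : ℕ, 0 < n →
        ∀ hcpt : Literature.NumberTheory.Automorphic.isCompact_glFiniteIntegralLevel n K,
          GlobalLanglandsCorrespondenceGLn n K R hcpt) := by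
  intro d
  induction d using Nat.strong_induction_on with
  | _ d ih =>
    intro K T _ _ _ _ _ _ _ hd hlt hT
    rcases galois_prime_step K T (hd ▸ hlt) with hprime | ⟨M, hGal, hpM, hsolv, h1, hltM⟩
    · exact hDown K T (hd ▸ hprime) hT
    · haveI := hGal
      haveI := hsolv
      haveI : FiniteDimensional K T := Module.Finite.of_restrictScalars_finite ℚ K T
      haveI : NumberField M := NumberField.of_module_finite K M
      exact hDown K M hpM (ih (Module.finrank M T) (hd ▸ hltM) M T rfl h1 hT)

/-- **Assembly of the split of `AscentConjugationSolvable`**: reciprocity ascent along Galois layers of prime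
degree (`CyclicPrimeAscent`, hypothesis `hUp`) and reciprocity descent along Galois layers of prime degree
(`CyclicPrimeDescent`, hypothesis `hDown`) imply the crux — reciprocity over totally real and CM fields gives
reciprocity over every conjugation-solvable field.  Given the witness `F₀ ⊆ F ⊆ E` (`F₀` totally real, `E/F₀`
Galois solvable): `E/F` is Galois with solvable group; if `[E:F] = 1`, `F/F₀` is Galois solvable (transport of
`IsGalois`/`IsSolvable` along `F ≃ₐ[F₀] E`) and either `[F:F₀] = 1` (`F` is totally real, hypothesis) or
reciprocity ascends from `F₀` to `F`; else it ascends from `F₀` to `E` and descends from `E` to `F`.  The CM half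
of the hypothesis is not needed (CM fields are quadratic over totally real ones).
[cite: ArthurClozelAMS120, Ch. 3 Thm. 4.2 and Thm. 6.2] -/
theorem ascentConjugationSolvable_of_cyclicPrime
    (hUp : ∀ (K L : Type) [Field K] [NumberField K] [Field L] [NumberField L] [Algebra K L] [IsGalois K L],
      (Module.finrank K L).Prime →
      (∃ R : ReciprocityData K, ∀ n : ℕ, 0 < n →
        ∀ hcpt : Literature.NumberTheory.Automorphic.isCompact_glFiniteIntegralLevel n K,
          GlobalLanglandsCorrespondenceGLn n K R hcpt) →
      ∃ R : ReciprocityData L, ∀ n : ℕ, 0 < n →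
        ∀ hcpt : Literature.NumberTheory.Automorphic.isCompact_glFiniteIntegralLevel n L,
          GlobalLanglandsCorrespondenceGLn n L R hcpt)
    (hDown : ∀ (K L : Type) [Field K] [NumberField K] [Field L] [NumberField L] [Algebra K L] [IsGalois K L],
      (Module.finrank K L).Prime →
      (∃ R : ReciprocityData L, ∀ n : ℕ, 0 < n →
        ∀ hcpt : Literature.NumberTheory.Automorphic.isCompact_glFiniteIntegralLevel n L,
          GlobalLanglandsCorrespondenceGLn n L R hcpt) →
      ∃ R : ReciprocityData K, ∀ n : ℕ, 0 < n →
        ∀ hcpt : Literature.NumberTheory.Automorphic.isCompact_glFiniteIntegralLevel n K,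
          GlobalLanglandsCorrespondenceGLn n K R hcpt) :
    Summit.Langlands.Langlands.Theses.SmithKummerSeed.AscentConjugationSolvable := by
  intro hTRCM F _ _ hF
  obtain ⟨F₀, E, iF₀, iNF₀, iE, iNE, iA₀, iA, iA₀E, iST, iGal, hTR, hsolv⟩ := hF
  letI := iF₀; letI := iNF₀; letI := iE; letI := iNE; letI := iA₀; letI := iA; letI := iA₀E
  haveI := iST; haveI := iGal; haveI := hTR; haveI := hsolv
  have hF₀ : (∃ R : ReciprocityData F₀, ∀ n : ℕ, 0 < n →
        ∀ hcpt : Literature.NumberTheory.Automorphic.isCompact_glFiniteIntegralLevel n F₀,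
          GlobalLanglandsCorrespondenceGLn n F₀ R hcpt) := hTRCM F₀ (Or.inl hTR)
  haveI : FiniteDimensional F₀ E := Module.Finite.of_restrictScalars_finite ℚ F₀ E
  haveI : FiniteDimensional F₀ F := Module.Finite.of_restrictScalars_finite ℚ F₀ F
  haveI : FiniteDimensional F E := Module.Finite.of_restrictScalars_finite ℚ F E
  -- `E/F` is Galois with solvable group (a subgroup of `Gal(E/F₀)` via restriction of scalars)
  haveI : IsGalois F E := IsGalois.tower_top_of_isGalois F₀ F E
  let res : (E ≃ₐ[F] E) →* (E ≃ₐ[F₀] E) :=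
    { toFun := fun e => e.restrictScalars F₀
      map_one' := by ext; rfl
      map_mul' := fun _ _ => by ext; rfl }
  have hres : Function.Injective res := fun e₁ e₂ h => by
    ext x
    exact AlgEquiv.congr_fun h x
  haveI : IsSolvable (E ≃ₐ[F] E) := solvable_of_solvable_injective hres
  by_cases hFE : Module.finrank F E = 1
  · -- degenerate top layer: `F ≃ E` over `F₀`, so `F/F₀` is itself Galois with solvable group
    have hbij : Function.Bijective (algebraMap F E) :=
      (Algebra.finrank_eq_one_iff_bijective_algebraMap).mp hFE
    let e : F ≃ₐ[F₀] E := AlgEquiv.ofBijective (IsScalarTower.toAlgHom F₀ F E) hbij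
    haveI : IsGalois F₀ F := IsGalois.of_algEquiv e.symm
    haveI : IsSolvable (F ≃ₐ[F₀] F) :=
      solvable_of_surjective (f := e.symm.autCongr.toMonoidHom) e.symm.autCongr.surjective
    by_cases hF₀F : Module.finrank F₀ F = 1
    · -- doubly degenerate: `F ≃ F₀` is totally real
      have hbij₀ : Function.Bijective (algebraMap F₀ F) :=
        (Algebra.finrank_eq_one_iff_bijective_algebraMap).mp hF₀F
      haveI : NumberField.IsTotallyReal F :=
        NumberField.IsTotallyReal.ofRingEquiv (RingEquiv.ofBijective (algebraMap F₀ F) hbij₀)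
      exact hTRCM F (Or.inl inferInstance)
    · exact recip_ascent_of_isSolvable hUp _ F₀ F rfl
        (lt_of_le_of_ne (Nat.succ_le_of_lt Module.finrank_pos) (Ne.symm hF₀F)) hF₀
  · have hltFE : 1 < Module.finrank F E :=
      lt_of_le_of_ne (Nat.succ_le_of_lt Module.finrank_pos) (Ne.symm hFE)
    have hltE : 1 < Module.finrank F₀ E :=
      calc 1 < Module.finrank F E := hltFE
        _ ≤ Module.finrank F₀ F * Module.finrank F E := Nat.le_mul_of_pos_left _ Module.finrank_pos
        _ = Module.finrank F₀ E := Module.finrank_mul_finrank F₀ F E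
    exact recip_descent_of_isSolvable hDown _ F E rfl hltFE
      (recip_ascent_of_isSolvable hUp _ F₀ E rfl hltE hF₀)

/-- **The split, by name**: the two ROUTE ITEMS `SmithKummerSeed.CyclicPrimeAscent` (stmt-Langlands-18649) and
`SmithKummerSeed.CyclicPrimeDescent` (stmt-Langlands-18645) imply the crux `SmithKummerSeed.AscentConjugationSolvable`
(stmt-Langlands-1094) — the glue of the decomposition, literally over the route decls (for `route edit --split …
--glue-by`). [cite: ArthurClozelAMS120, Ch. 3 Thm. 4.2 and Thm. 6.2] -/
theorem ascentConjugationSolvable_of_pieces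
    (hUp : Summit.Langlands.Langlands.Theses.SmithKummerSeed.CyclicPrimeAscent)
    (hDown : Summit.Langlands.Langlands.Theses.SmithKummerSeed.CyclicPrimeDescent) :
    Summit.Langlands.Langlands.Theses.SmithKummerSeed.AscentConjugationSolvable :=
  ascentConjugationSolvable_of_cyclicPrime hUp hDown

/-- **The glue item, by name**: the route's support item `SmithKummerSeed.AscentConjugationSolvableOfCyclicPrime`
(stmt-Langlands-19073, `CyclicPrimeAscent → CyclicPrimeDescent → AscentConjugationSolvable`) holds — so the crux
`AscentConjugationSolvable` (stmt-Langlands-1094) is DERIVED from the two pieces. A prover lands this file verbatim as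
`Summits/Langlands/Langlands/Theorems/SmithKummerSeedAscentConjugationSolvableSplit.lean --workitem stmt-Langlands-19073`.
[cite: ArthurClozelAMS120, Ch. 3 Thm. 4.2 and Thm. 6.2] -/
theorem ascentConjugationSolvableOfCyclicPrime_proof :
    Summit.Langlands.Langlands.Theses.SmithKummerSeed.AscentConjugationSolvableOfCyclicPrime :=
  fun hUp hDown => ascentConjugationSolvable_of_pieces hUp hDown

end Summit.Langlands.Langlands.Theorems.AscentConjugationSolvableSplit

end
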